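import Summits.QuantumFields.BalabanUV.T4Continuum.Support.RegionInteriorGaffney
import Summits.QuantumFields.BalabanUV.T4Continuum.Support.DirichletStarClassPoincare

/-!
# T⁴ programme, spine node NE2 (U1a), sub-row Δ1 «NE2⁰-Dirichlet» — INTERIOR W2 FROM W1 ON PRODUCT REGIONS: the interior gradient-form
# bound `Σ_μ ‖igrad_μ A‖² ≤ CgI·Re⟨A, Δ_a(Ω₀)A⟩` with ONE level-free `CgI = 1 + γ′⁻³σ₀⁻⁴·γ⋆⁻¹` from the slice inequality alone, and the
# defect-free star tower of the faithful `Δ_a(Ω₀)` at the TORUS RATE `L⁻¹` modulo W1 + W3̃ ONLY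

NE2 formalisation swarm `b2b-balaban-t4-ne2-formalise-*`, LEAF PROVER 07 (gen 7), supplier item «Δ1-VEC-INTERIOR-W2-BOX», file 3 of 3, on
file 2 `Support/RegionInteriorGaffney` (`interior_gaffney_box`: `Σ_μ ‖igrad_μ A‖² ≤ ‖curlR A‖² + ‖gradRᴴ A‖²` on every product region
at `n ≥ 2`) and this seat's `Support/DirichletStarClassPoincare` (p229963: `towerLimitRate_star_renorm_of_interior`).  The faithful form is
`Re⟨A, Δ_a(Ω₀)A⟩ = ‖curlR A‖² + ‖R·gradRᴴA‖² + a n^d‖QA‖²` (`RegionGaugeFixedVector.form_regionDeltaA`) with `R = 1 − P`, `P = gaugeP G′_Ω Q′_Ω`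
the region gauge projection of [B9] (3.25) (rank = number of blocks of `Ω`); so the interior Gaffney inequality misses the form exactly by
`‖P·gradRᴴA‖²`, which THIS FILE bounds level-uniformly:

 * §1 `nsq_div_eq_add`: `‖gradRᴴA‖² = ‖R gradRᴴA‖² + ‖P gradRᴴA‖²` (orthogonal Hermitian idempotents);
 * §2 **`nsq_GOm_div_le`**: `‖G′_Ω·gradRᴴA‖² ≤ γ′⁻¹·‖A‖²` (the energy argument `D^Ω ≥ gradRᴴgradR`, `D^Ω ≥ γ′`) and
   **`nsq_gaugeP_div_le`**: `‖P·gradRᴴA‖² ≤ γ′⁻³·σ₀⁻⁴·‖A‖²` UNIFORMLY in `n`, the torus and `S` (tree bounds `opNorm_inv_DOm_le`,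
   `opNorm_inv_gramK_region_le` (`n^d σ₀⁻²`) against `nsq_QOm_mulVec_le` / `‖Q′_Ω‖² ≤ n^{−d}` — the powers of `n` cancel);
 * §3 **`interiorW2_of_slice (hn : 2 ≤ n) (hbox : IsCoordBox M S) (ha : 0 ≤ a) (ha′ : 0 < a′) (hc : 0 < c) (hS : SliceCoercive … c)`**:
   `∀ A, Σ_μ nsq (igrad M S n μ A) ≤ CgIbox d a′ c · Re⟨A, regionDeltaA n M a a′ S A⟩`, **`CgIbox d a′ c = 1 + γ′⁻³σ₀⁻⁴·γ⋆⁻¹`**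
   (`γ′ = gammaPs d a′`, `σ₀ = sigma0 d a′`, `γ⋆ = gamStar d a′ c`) — INTERIOR W2 ⟸ W1 on product regions, level-free;
 * §4 the END **`towerLimitRate_star_renorm_box_of_slice (hL : 2 ≤ L) (hbox) (ha) (ha′) (hc) (hS : ∀ k, SliceCoercive_k … c)
   (hinj : … ≤ C₁·(L⁻¹)^k)`** = `DirichletStarClassPoincare.towerLimitRate_star_renorm_of_interior` with `hI` DISCHARGED: on every product
   region the defect-free star tower of the faithful `Δ_a(Ω₀)` converges at the TORUS RATE `L⁻¹` modulo W1 (`hS`, ONE slice constant) and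
   W3̃ (`hinj`) ONLY, constant `Cpert 0 √(CgIbox/2·γ⋆⁻¹) C₁ 0 0 0`.

HONEST FRAMING (T4-DAG p. 1).  Model level (`U = 1`, ONE region = a product of block sets, ONE averaging scale, finite torus, linear
layer, operator norm); statements / constants OURS ([folklore]); W1 (`SliceCoercive` with ONE constant uniformly in `n` — the crew's located
open estimate G-ne2leaf07g5-1) and W3̃ stay DISPLAYED; re-entrant unions NOT covered (there the growth class of p230560 applies); NE2 (U1a)
NOT proved; spine 0/9 unchanged; NOT [B9] (3.16)/(3.23)–(3.27) as printed; NOT infinite volume, NOT a mass gap, NOT the Clay problem, NOT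
summit progress.  HONEST DEPENDENCY: continuum YM on T⁴ ⇐ BetaPertH ∧ nine spine estimates (0/9 proved); BetaPertH ⇐ (D1) ∧ (D4) ∧
CAP+tail; G-an2-4 gates asym, D1 and NE2/3/4.  No `sorry`.
-/

noncomputable section

open scoped BigOperators ComplexConjugate Matrix Matrix.Norms.L2Operator
open Finset

namespace Summit.QuantumFields.BalabanUV.T4Continuum.RegionInteriorW2

open Literature.MathematicalPhysics.QuantumFieldTheory.Balaban1983to89.B5Prop11Plancherel (Tor fine unitVec)
open Literature.MathematicalPhysics.QuantumFieldTheory.Balaban1983to89.B5Prop11Lower (nsq nsq_nonneg nsq_mulVec_le star_dotProduct_self)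
open Literature.MathematicalPhysics.QuantumFieldTheory.Balaban1983to89.B5Action121 (LapS star_mulVec_dotProduct)
open Literature.MathematicalPhysics.QuantumFieldTheory.Balaban1983to89.B5G183RateUnitTower (lev)
open Summit.QuantumFields.BalabanUV.T4Continuum
open Summit.QuantumFields.BalabanUV.T4Continuum.CovariantAveragingTower (TowerLimitRate)
open Summit.QuantumFields.BalabanUV.T4Continuum.CovariantBlockAveraging (opNorm_le_of_sq_le')
open Summit.QuantumFields.BalabanUV.T4Continuum.BalabanBlockPoincare (nsq_mulVec_le_rect)
open Summit.QuantumFields.BalabanUV.T4Continuum.BackgroundResolventTower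
open Summit.QuantumFields.BalabanUV.T4Continuum.SubtypeCompression
open Summit.QuantumFields.BalabanUV.T4Continuum.ScalarAveragedPropagator (DeltaPs gammaPs gammaPs_pos re_star_dotProduct_le)
open Summit.QuantumFields.BalabanUV.T4Continuum.ScalarAveragedCompression (sigma0 sigma0_pos)
open Summit.QuantumFields.BalabanUV.T4Continuum.ScalarBlockPoincare (PiS form_PiS)
open Summit.QuantumFields.BalabanUV.T4Continuum.RegionGaugeProjection (gramK gaugeP gaugeR gaugeP_isHermitian gaugeP_mul_gaugeP
  gaugeR_isHermitian gaugeR_mul_gaugeR)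
open Summit.QuantumFields.BalabanUV.T4Continuum.RegionGaugeSlice (SliceCoercive form_proj form_gram)
open Summit.QuantumFields.BalabanUV.T4Continuum.RegionScalarCompression (QOm GOm GOm_isHermitian DOm_mul_GOm nsq_QOm_mulVec_le
  opNorm_inv_gramK_region_le isUnit_det_gramK_region)
open Summit.QuantumFields.BalabanUV.T4Continuum.RegionGaugeFixedVector (starReg curlR gradR avgR regionDeltaA form_regionDeltaA
  gradR_conjTranspose_mul_gradR toBlock_PiS)
open Summit.QuantumFields.BalabanUV.T4Continuum.DirichletSubregionTowerOf (pidx)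
open Summit.QuantumFields.BalabanUV.T4Continuum.DirichletSubregionRenormTower (JnR AnR)
open Summit.QuantumFields.BalabanUV.T4Continuum.DirichletStarVectorTower (starP gamStar gamStar_pos coercive_regionDeltaA_of_slice
  two_le_lev_succ)
open Summit.QuantumFields.BalabanUV.T4Continuum.DirichletStarRenormTower (igrad)
open Summit.QuantumFields.BalabanUV.T4Continuum.DirichletStarClassPoincare (towerLimitRate_star_renorm_of_interior)
open Summit.QuantumFields.BalabanUV.T4Continuum.RegionInteriorGaffney (interior_gaffney_box)
open Summit.QuantumFields.BalabanUV.Beta.GAN24.DirichletBoxCompression (DOm opNorm_inv_DOm_le coercive_DeltaPs)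
open Summit.QuantumFields.BalabanUV.Beta.GAN24.DirichletBoxTrace (blockReg)
open Summit.QuantumFields.BalabanUV.Beta.GAN24.DirichletBoxTwoLevel (IsCoordBox)

variable {d : ℕ}

section Region

variable (n : ℕ) [NeZero n] (M : Fin d → ℕ) [hM : ∀ μ, NeZero (M μ)] (a a' : ℝ) (S : Tor M → Prop) [DecidablePred S]

/-! ## §1 The divergence splits orthogonally along `1 = R + P` -/

/-- `‖u‖² = ‖R u‖² + ‖P u‖²` for the region gauge projection `P = gaugeP G′_Ω Q′_Ω`, `R = 1 − P` (Hermitian idempotents). [folklore] -/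
theorem nsq_eq_add (ha' : 0 < a') (u : {x // blockReg n M S x} → ℂ) :
    nsq u = nsq (gaugeR (GOm n M a' S) (QOm n M S) *ᵥ u) + nsq (gaugeP (GOm n M a' S) (QOm n M S) *ᵥ u) := by
  have hG := GOm_isHermitian n M a' S
  have hK := isUnit_det_gramK_region n M a' S ha'
  have e : (1 : Matrix {x // blockReg n M S x} {x // blockReg n M S x} ℂ)
      = gaugeR (GOm n M a' S) (QOm n M S) + gaugeP (GOm n M a' S) (QOm n M S) := by
    unfold gaugeR; abel
  have h : star u ⬝ᵥ u = star u ⬝ᵥ ((gaugeR (GOm n M a' S) (QOm n M S) + gaugeP (GOm n M a' S) (QOm n M S)) *ᵥ u) := by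
    rw [← e, Matrix.one_mulVec]
  rw [Matrix.add_mulVec, dotProduct_add, form_proj (gaugeR_isHermitian _ _ hG) (gaugeR_mul_gaugeR _ _ hK),
    form_proj (gaugeP_isHermitian _ _ hG) (gaugeP_mul_gaugeP _ _ hK), star_dotProduct_self, ← Complex.ofReal_add] at h
  exact_mod_cast h

/-! ## §2 The gauge-projection part of the divergence is bounded level-uniformly -/

/-- the form of the region scalar operator dominates the Dirichlet energy: `nsq (gradR v) ≤ Re⟨v, D^Ω v⟩`. [folklore] -/
theorem nsq_gradR_le_form_DOm (v : {x // blockReg n M S x} → ℂ) (ha' : 0 ≤ a') :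
    nsq (gradR n M S *ᵥ v) ≤ (star v ⬝ᵥ (DOm n M a' (blockReg n M S) *ᵥ v)).re := by
  have e : DOm n M a' (blockReg n M S) = (gradR n M S)ᴴ * gradR n M S + (a' : ℂ) • (PiS n M).toBlock (blockReg n M S) (blockReg n M S) := by
    unfold DOm DeltaPs
    rw [toBlock_add, toBlock_smul, gradR_conjTranspose_mul_gradR]
  rw [e, Matrix.add_mulVec, dotProduct_add, Complex.add_re, form_gram, Complex.ofReal_re, Matrix.smul_mulVec, dotProduct_smul,
    form_toBlock, form_PiS, smul_eq_mul, ← Complex.ofReal_mul, Complex.ofReal_re]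
  have := nsq_nonneg (PiS n M *ᵥ ext (blockReg n M S) v)
  nlinarith

/-- **`‖G′_Ω·gradRᴴA‖² ≤ γ′⁻¹·‖A‖²`** (`γ′ = gammaPs d a′`): the energy argument. [folklore] -/
theorem nsq_GOm_div_le (ha' : 0 < a') (A : {b // starReg n M S b} → ℂ) :
    nsq (GOm n M a' S *ᵥ ((gradR n M S)ᴴ *ᵥ A)) ≤ (gammaPs d a')⁻¹ * nsq A := by
  set v := GOm n M a' S *ᵥ ((gradR n M S)ᴴ *ᵥ A) with hv
  have hγ := (gammaPs_pos (d := d) (a' := a')).1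
  -- `D^Ω v = gradRᴴ A`
  have hDv : DOm n M a' (blockReg n M S) *ᵥ v = (gradR n M S)ᴴ *ᵥ A := by
    rw [hv, Matrix.mulVec_mulVec, DOm_mul_GOm n M a' S ha', Matrix.one_mulVec]
  set F : ℝ := (star v ⬝ᵥ (DOm n M a' (blockReg n M S) *ᵥ v)).re with hF
  -- coercivity and the Dirichlet energy from below
  have h1 : gammaPs d a' * nsq v ≤ F := coercive_toBlock (blockReg n M S) (coercive_DeltaPs n M a' ha') v
  have h2 : nsq (gradR n M S *ᵥ v) ≤ F := nsq_gradR_le_form_DOm n M a' S v ha'.le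
  -- Cauchy–Schwarz from above: `F = Re⟨gradR v, A⟩`
  have h3 : F ≤ Real.sqrt (nsq (gradR n M S *ᵥ v)) * Real.sqrt (nsq A) := by
    rw [hF, hDv, ← star_mulVec_dotProduct]
    exact re_star_dotProduct_le _ _
  have hF0 : 0 ≤ F := (nsq_nonneg _).trans h2
  have h4 : F ≤ Real.sqrt F * Real.sqrt (nsq A) :=
    h3.trans (mul_le_mul_of_nonneg_right (Real.sqrt_le_sqrt h2) (Real.sqrt_nonneg _))
  have h5 : F ≤ nsq A := by
    have hsF : Real.sqrt F * Real.sqrt F = F := Real.mul_self_sqrt hF0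
    have hsA : Real.sqrt (nsq A) * Real.sqrt (nsq A) = nsq A := Real.mul_self_sqrt (nsq_nonneg _)
    nlinarith [Real.sqrt_nonneg F, Real.sqrt_nonneg (nsq A), h4]
  calc nsq v = (gammaPs d a')⁻¹ * (gammaPs d a' * nsq v) := by field_simp
    _ ≤ (gammaPs d a')⁻¹ * nsq A := mul_le_mul_of_nonneg_left (h1.trans h5) (inv_nonneg.mpr hγ.le)

omit [DecidablePred S] in
/-- `‖Q′_Ω‖² ≤ n^{−d}` in operator norm. [folklore] -/
theorem opNorm_QOm_le [DecidablePred S] : ‖QOm n M S‖ ≤ (Real.sqrt ((n : ℝ) ^ d))⁻¹ := by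
  have hn : (0 : ℝ) < (n : ℝ) ^ d := pow_pos (by exact_mod_cast Nat.pos_of_ne_zero (NeZero.ne n)) d
  refine opNorm_le_of_sq_le' _ (inv_nonneg.mpr (Real.sqrt_nonneg _)) fun x => ?_
  have h := nsq_QOm_mulVec_le n M S x
  rw [inv_pow, Real.sq_sqrt hn.le]
  have e1 : ∑ i, ‖∑ j, QOm n M S i j * x j‖ ^ 2 = nsq (QOm n M S *ᵥ x) := rfl
  have e2 : ∑ j, ‖x j‖ ^ 2 = nsq x := rfl
  rw [e1, e2, ← div_eq_inv_mul, le_div_iff₀ hn, mul_comm]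
  exact h

/-- **`‖P·gradRᴴA‖² ≤ γ′⁻³·σ₀⁻⁴·‖A‖²`** — LEVEL-FREE (the `n^d` of `‖(Q′G′²Q′ᴴ)⁻¹‖ ≤ n^d σ₀⁻²` cancels against `‖Q′‖² ≤ n^{−d}` twice). [folklore] -/
theorem nsq_gaugeP_div_le (ha' : 0 < a') (A : {b // starReg n M S b} → ℂ) :
    nsq (gaugeP (GOm n M a' S) (QOm n M S) *ᵥ ((gradR n M S)ᴴ *ᵥ A))
      ≤ ((gammaPs d a')⁻¹) ^ 3 * (((sigma0 d a') ^ 2)⁻¹) ^ 2 * nsq A := by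
  have hn : (0 : ℝ) < (n : ℝ) ^ d := pow_pos (by exact_mod_cast Nat.pos_of_ne_zero (NeZero.ne n)) d
  have hγ := (gammaPs_pos (d := d) (a' := a')).1
  have hσ : 0 < ((sigma0 d a') ^ 2)⁻¹ := inv_pos.mpr (pow_pos (sigma0_pos (d := d) ha') 2)
  set G := GOm n M a' S
  set Q := QOm n M S
  set v := G *ᵥ ((gradR n M S)ᴴ *ᵥ A) with hv
  have hG : ‖G‖ ≤ (gammaPs d a')⁻¹ := opNorm_inv_DOm_le n M a' (blockReg n M S) ha'
  have hK : ‖(gramK G Q)⁻¹‖ ≤ (n : ℝ) ^ d * ((sigma0 d a') ^ 2)⁻¹ := opNorm_inv_gramK_region_le n M a' S ha'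
  have hQ : ‖Q‖ ^ 2 ≤ ((n : ℝ) ^ d)⁻¹ := by
    have h := opNorm_QOm_le n M S
    calc ‖Q‖ ^ 2 ≤ ((Real.sqrt ((n : ℝ) ^ d))⁻¹) ^ 2 := pow_le_pow_left₀ (norm_nonneg _) h 2
      _ = ((n : ℝ) ^ d)⁻¹ := by rw [inv_pow, Real.sq_sqrt hn.le]
  -- `P (gradRᴴA) = G (Qᴴ (K⁻¹ (Q v)))`
  have eP : gaugeP G Q *ᵥ ((gradR n M S)ᴴ *ᵥ A) = G *ᵥ (Qᴴ *ᵥ ((gramK G Q)⁻¹ *ᵥ (Q *ᵥ v))) := by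
    simp only [gaugeP, hv, Matrix.mulVec_mulVec, Matrix.mul_assoc]
  rw [eP]
  have s1 : nsq (G *ᵥ (Qᴴ *ᵥ ((gramK G Q)⁻¹ *ᵥ (Q *ᵥ v)))) ≤ ((gammaPs d a')⁻¹) ^ 2 * nsq (Qᴴ *ᵥ ((gramK G Q)⁻¹ *ᵥ (Q *ᵥ v))) :=
    (nsq_mulVec_le _ _).trans (mul_le_mul_of_nonneg_right (pow_le_pow_left₀ (norm_nonneg _) hG 2) (nsq_nonneg _))
  have s2 : nsq (Qᴴ *ᵥ ((gramK G Q)⁻¹ *ᵥ (Q *ᵥ v))) ≤ ((n : ℝ) ^ d)⁻¹ * nsq ((gramK G Q)⁻¹ *ᵥ (Q *ᵥ v)) :=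
    (nsq_mulVec_le_rect _ _).trans (mul_le_mul_of_nonneg_right (by rw [Matrix.l2_opNorm_conjTranspose]; exact hQ) (nsq_nonneg _))
  have s3 : nsq ((gramK G Q)⁻¹ *ᵥ (Q *ᵥ v)) ≤ ((n : ℝ) ^ d * ((sigma0 d a') ^ 2)⁻¹) ^ 2 * nsq (Q *ᵥ v) :=
    (nsq_mulVec_le _ _).trans (mul_le_mul_of_nonneg_right (pow_le_pow_left₀ (norm_nonneg _) hK 2) (nsq_nonneg _))
  have s4 : nsq (Q *ᵥ v) ≤ ((n : ℝ) ^ d)⁻¹ * nsq v := by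
    rw [← div_eq_inv_mul, le_div_iff₀ hn, mul_comm]; exact nsq_QOm_mulVec_le n M S v
  have s5 : nsq v ≤ (gammaPs d a')⁻¹ * nsq A := nsq_GOm_div_le n M a' S ha' A
  have hγi : 0 ≤ (gammaPs d a')⁻¹ := inv_nonneg.mpr hγ.le
  have hni : 0 ≤ ((n : ℝ) ^ d)⁻¹ := inv_nonneg.mpr hn.le
  calc nsq (G *ᵥ (Qᴴ *ᵥ ((gramK G Q)⁻¹ *ᵥ (Q *ᵥ v))))
      ≤ ((gammaPs d a')⁻¹) ^ 2 * (((n : ℝ) ^ d)⁻¹ * (((n : ℝ) ^ d * ((sigma0 d a') ^ 2)⁻¹) ^ 2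
          * (((n : ℝ) ^ d)⁻¹ * ((gammaPs d a')⁻¹ * nsq A)))) := by
        refine s1.trans (mul_le_mul_of_nonneg_left ?_ (pow_nonneg hγi 2))
        refine s2.trans (mul_le_mul_of_nonneg_left ?_ hni)
        refine s3.trans (mul_le_mul_of_nonneg_left ?_ (sq_nonneg _))
        exact s4.trans (mul_le_mul_of_nonneg_left s5 hni)
    _ = ((gammaPs d a')⁻¹) ^ 3 * (((sigma0 d a') ^ 2)⁻¹) ^ 2 * nsq A := by
        field_simp

/-! ## §3 Interior W2 from W1 on product regions -/

/-- the level-free interior constant on product regions: `1 + γ′⁻³σ₀⁻⁴·γ⋆⁻¹`. [folklore] -/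
def CgIbox (d : ℕ) (a' c : ℝ) : ℝ := 1 + ((gammaPs d a')⁻¹) ^ 3 * (((sigma0 d a') ^ 2)⁻¹) ^ 2 * (gamStar d a' c)⁻¹

/-- `1 ≤ CgIbox` (in particular `0 ≤ CgIbox`). [folklore] -/
theorem one_le_CgIbox (ha' : 0 < a') {c : ℝ} (hc : 0 < c) : 1 ≤ CgIbox d a' c := by
  unfold CgIbox
  have := (gammaPs_pos (d := d) (a' := a')).1
  have := sigma0_pos (d := d) ha'
  have := gamStar_pos (d := d) a' hc
  have : 0 ≤ ((gammaPs d a')⁻¹) ^ 3 * (((sigma0 d a') ^ 2)⁻¹) ^ 2 * (gamStar d a' c)⁻¹ := by positivity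
  linarith

/-- **INTERIOR W2 ⟸ W1 ON PRODUCT REGIONS**: at every level `n ≥ 2`, on every `IsCoordBox`, for `0 ≤ a`, `0 < a′` and a slice constant
`c > 0`: `Σ_μ ‖igrad_μ A‖² ≤ CgIbox·Re⟨A, Δ_a(Ω₀)A⟩` for EVERY `A`. [folklore] -/
theorem interiorW2_of_slice (hn : 2 ≤ n) (hbox : IsCoordBox M S) (ha : 0 ≤ a) (ha' : 0 < a') {c : ℝ} (hc : 0 < c)
    (hS : SliceCoercive (curlR n M S) (gradR n M S) (GOm n M a' S) (QOm n M S) (avgR n M S) (a * (n : ℝ) ^ d) c)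
    (A : {b // starReg n M S b} → ℂ) :
    ∑ μ, nsq (igrad M S n μ A) ≤ CgIbox d a' c * (star A ⬝ᵥ (regionDeltaA n M a a' S *ᵥ A)).re := by
  have hγs := gamStar_pos (d := d) a' hc
  set F := (star A ⬝ᵥ (regionDeltaA n M a a' S *ᵥ A)).re with hF
  have hcoer : gamStar d a' c * nsq A ≤ F := coercive_regionDeltaA_of_slice n M a a' S ha' hc hS A
  have hform := form_regionDeltaA n M a a' S ha' A
  have hgaff := interior_gaffney_box n M S hn hbox A
  have hsplit := nsq_eq_add n M a' S ha' ((gradR n M S)ᴴ *ᵥ A)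
  have hP := nsq_gaugeP_div_le n M a' S ha' A
  have hmass : 0 ≤ a * (n : ℝ) ^ d * nsq (avgR n M S *ᵥ A) := by have := nsq_nonneg (avgR n M S *ᵥ A); positivity
  set CP := ((gammaPs d a')⁻¹) ^ 3 * (((sigma0 d a') ^ 2)⁻¹) ^ 2 with hCP
  have hCP0 : 0 ≤ CP := by
    have := (gammaPs_pos (d := d) (a' := a')).1; have := sigma0_pos (d := d) ha'; positivity
  -- `Σ igrad² ≤ F + CP·‖A‖² ≤ F + CP·γ⋆⁻¹·F`
  have h1 : ∑ μ, nsq (igrad M S n μ A) ≤ F + CP * nsq A := by rw [hF, hform]; linarith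
  have h2 : nsq A ≤ (gamStar d a' c)⁻¹ * F := by
    rw [← div_eq_inv_mul, le_div_iff₀ hγs, mul_comm]; exact hcoer
  calc ∑ μ, nsq (igrad M S n μ A) ≤ F + CP * ((gamStar d a' c)⁻¹ * F) := h1.trans (by nlinarith [mul_le_mul_of_nonneg_left h2 hCP0])
    _ = CgIbox d a' c * F := by rw [CgIbox, ← hCP]; ring

end Region

/-! ## §4 The END: the star tower of a product region at the torus rate modulo W1 + W3̃ -/

section End

variable (L : ℕ) [NeZero L] (M : Fin d → ℕ) [hM : ∀ μ, NeZero (M μ)] (S : Tor M → Prop) [DecidablePred S] (a a' : ℝ)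

/-- **THE DEFECT-FREE STAR TOWER OF `Δ_a(Ω₀)` ON A PRODUCT REGION CONVERGES AT THE TORUS RATE `L⁻¹` MODULO W1 + W3̃** — this seat's
`DirichletStarClassPoincare.towerLimitRate_star_renorm_of_interior` with the interior gradient-form bound `hI` DISCHARGED by
`interiorW2_of_slice` (levels `k + 1` have `n = L^{k+1} ≥ 2`).  DISPLAYED: W1 `hS` (ONE slice constant `c` for all levels), W3̃ `hinj`.
[folklore] -/
theorem towerLimitRate_star_renorm_box_of_slice (hL : 2 ≤ L) (hbox : IsCoordBox M S) (ha : 0 ≤ a) (ha' : 0 < a') {c : ℝ} (hc : 0 < c)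
    (hS : ∀ k, SliceCoercive (curlR (lev L k) M S) (gradR (lev L k) M S) (GOm (lev L k) M a' S) (QOm (lev L k) M S)
      (avgR (lev L k) M S) (a * ((lev L k : ℕ) : ℝ) ^ d) c)
    {C₁ : ℝ}
    (hinj : ∀ k, ‖(regionDeltaA (lev L (k + 1)) M a a' S)⁻¹ * JnR L M (starP L M S) k
        - JnR L M (starP L M S) k * (regionDeltaA (lev L k) M a a' S)⁻¹‖ ≤ C₁ * ((L : ℝ)⁻¹) ^ k) :
    TowerLimitRate (AnR L M (starP L M S)) ((L : ℝ) ^ d) (fun k => (regionDeltaA (lev L k) M a a' S)⁻¹)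
      (Cpert 0 (Real.sqrt (CgIbox d a' c / 2 * (gamStar d a' c)⁻¹)) C₁ 0 0 0) ((L : ℝ)⁻¹) :=
  towerLimitRate_star_renorm_of_interior L M S a a' ha' hc hS (zero_le_one.trans (one_le_CgIbox (d := d) a' ha' hc))
    (fun k A => interiorW2_of_slice (lev L (k + 1)) M a a' S (two_le_lev_succ L hL k) hbox ha ha' hc (hS (k + 1)) A) hL hinj

/-- **THE SAME AT ANY GEOMETRIC RATE `θ ∈ [L⁻¹, 1)`** (v1.1; the honest form after leaf-02-g7's slab no-go for W3̃ at the torus rate,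
«Δ1-VEC-W3̃-SLAB-NOGO»: off `⊤` the injected law for `J̃` is inhabitable only at rates `θ ≥ (√L)⁻¹`): on a product region, W1 with ONE slice
constant and the injected law W3̃ AT RATE `θ` give convergence of the defect-free star tower AT RATE `θ` — the interior-W2 socket contributes
the torus rate and is never the bottleneck (`DirichletStarClassPoincare.towerLimitRate_star_renorm_of_interior_class` with the constant class
`CgI_k = CgIbox ≤ CgIbox·((L·θ)^k)²`, `L·θ ≥ 1`). [folklore] -/
theorem towerLimitRate_star_renorm_box_of_slice_rate (hL : 2 ≤ L) (hbox : IsCoordBox M S) (ha : 0 ≤ a) (ha' : 0 < a') {c : ℝ}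
    (hc : 0 < c)
    (hS : ∀ k, SliceCoercive (curlR (lev L k) M S) (gradR (lev L k) M S) (GOm (lev L k) M a' S) (QOm (lev L k) M S)
      (avgR (lev L k) M S) (a * ((lev L k : ℕ) : ℝ) ^ d) c)
    {θ : ℝ} (hθL : ((L : ℝ))⁻¹ ≤ θ) (hθ1 : θ < 1) {C₁ : ℝ}
    (hinj : ∀ k, ‖(regionDeltaA (lev L (k + 1)) M a a' S)⁻¹ * JnR L M (starP L M S) k
        - JnR L M (starP L M S) k * (regionDeltaA (lev L k) M a a' S)⁻¹‖ ≤ C₁ * θ ^ k) :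
    TowerLimitRate (AnR L M (starP L M S)) ((L : ℝ) ^ d) (fun k => (regionDeltaA (lev L k) M a a' S)⁻¹)
      (Cpert 0 (Real.sqrt (CgIbox d a' c / 2 * (gamStar d a' c)⁻¹)) C₁ 0 0 0) θ := by
  have hL0 : (0 : ℝ) < L := by exact_mod_cast lt_of_lt_of_le (by norm_num) hL
  have hθ0 : 0 ≤ θ := (inv_nonneg.mpr hL0.le).trans hθL
  have hLθ : 1 ≤ (L : ℝ) * θ := by
    have := mul_le_mul_of_nonneg_left hθL hL0.le
    rwa [mul_inv_cancel₀ hL0.ne'] at this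
  have hC0 : 0 ≤ CgIbox d a' c := zero_le_one.trans (one_le_CgIbox (d := d) a' ha' hc)
  have hCg : ∀ k : ℕ, CgIbox d a' c ≤ CgIbox d a' c * (((L : ℝ) * θ) ^ k) ^ 2 := by
    intro k
    have h1 : (1 : ℝ) ≤ (((L : ℝ) * θ) ^ k) ^ 2 := one_le_pow₀ (one_le_pow₀ hLθ)
    nlinarith
  exact DirichletStarClassPoincare.towerLimitRate_star_renorm_of_interior_class L M S a a' ha' hc hS hθ0 hθ1 (fun _ => hC0) hCg
    (fun k A => interiorW2_of_slice (lev L (k + 1)) M a a' S (two_le_lev_succ L hL k) hbox ha ha' hc (hS (k + 1)) A) hinj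

end End

end Summit.QuantumFields.BalabanUV.T4Continuum.RegionInteriorW2

end
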